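import Literature.Probability.LatticeModels.IsingModel
import Literature.Probability.LatticeModels.TorusFourier
import HarnessLib

/-!
# Transport of finite-volume Ising measures along graph embeddings

Trunk G02 (T-STATMECH), topic `Probability/LatticeModels`, namespace `Literature.StatMech`.

The finite-volume Ising Gibbs measure with **free** boundary condition in a volume `Λ` only
depends on the graph induced on `Λ`; hence its expectations are transported along any injection
`φ : V ↪ V'` which is a graph isomorphism between `Λ` and `φ(Λ)` (induced subgraphs).
This elementary bookkeeping fact (Friedli–Velenik 2017, §3.1: the free Hamiltonian `ℋ_{Λ;β,h}^∅`
involves only the edges of `ℰ_Λ`) is used for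

* translation (and reflection) invariance of the periodic (torus) two-point function
  `⟨σ_x σ_y⟩_{𝕋_L} = ⟨σ_0 σ_{y-x}⟩_{𝕋_L}` (Friedli–Velenik 2017, §3.1 Def. 3.2 (periodic boundary
  condition) and §10.5.2, display before (10.40): "by translation invariance"; the Fourier
  analysis of the torus two-point function presupposes it);
* the comparison of a free box `Λ_n ⊆ ℤ^d` with its image in the torus `(ℤ/Lℤ)^d`
  (Aizenman–Duminil-Copin–Sidoravicius 2015, §3.3, proof of (3.19)).

## Contents

* `SpinConfig.extendAlong φ σ` — the configuration on `V'` equal to `σ` on `φ(V)` (transported)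
  and to `1` elsewhere (Mathlib `Function.extend`).
* `isingHamiltonian_free_map` — `ℋ^∅_{φ(Λ)}(extendAlong φ σ) = ℋ^∅_Λ(σ)`.
* `isingExpect_free_map` — **transport**: for measurable `f`,
  `⟨f⟩^∅_{φ(Λ);β,h} = ⟨f ∘ extendAlong φ⟩^∅_{Λ;β,h}` (proved from the tree's finite-sum formula
  `integral_isingMeasure`).
* `isingCorr_free_map`, `isingTwoPoint_free_map` — `⟨σ_{φ(A)}⟩^∅_{φ(Λ)} = ⟨σ_A⟩^∅_Λ`,
  `⟨σ_{φ x} σ_{φ y}⟩^∅_{φ(Λ)} = ⟨σ_x σ_y⟩^∅_Λ`.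
* Torus corollaries: `isingTorusTwoPoint_add_right` (translation invariance),
  `isingTorusTwoPoint_comm`, `isingTorusTwoPoint_eq_torusTwoPoint`
  (`⟨σ_xσ_y⟩_{𝕋_L} = G_L(y - x)`), `torusTwoPoint_isingTorusMeasure_neg` (`G_L` is even).

The bijection `Λ ≃ φ(Λ)` is Mathlib's `Set.BijOn.equiv` (`exists_equiv_map`, used only through
`↑(e x) = φ x`); the same bookkeeping equivalence exists downstream as
`Literature.MathematicalPhysics.QuantumLattice.finsetMapEquiv` (`MathematicalPhysics/QuantumLattice/LocalDynamics.lean`, which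
imports this topic), deliberately not duplicated here.

## Mathlib status

No Ising model in Mathlib. Anchors: `Function.extend`, `Finset.map`, `Sym2.map`,
`Fintype.sum_equiv`, `Equiv.addRight`, `Set.BijOn.equiv`.
-/

noncomputable section

open MeasureTheory Finset

namespace Literature.Probability.LatticeModels

variable {V V' : Type*}

/-! ### Transporting configurations along an injection -/

/-- Transport of a spin configuration `σ` on `V` along an injection `φ : V ↪ V'`: the
configuration on `V'` equal to `σ x` at `φ x` and to `1` off the range of `φ` (the value the
free boundary condition glues outside the volume). (Friedli–Velenik 2017, §3.1.) [cite: FriedliVelenik2017, §3.1] -/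
def SpinConfig.extendAlong (φ : V ↪ V') (σ : SpinConfig V) : SpinConfig V' :=
  Function.extend φ σ 1

/-- On the range, the transported configuration is the original one. [folklore] -/
@[simp] theorem SpinConfig.extendAlong_apply (φ : V ↪ V') (σ : SpinConfig V) (x : V) :
    SpinConfig.extendAlong φ σ (φ x) = σ x :=
  φ.injective.extend_apply _ _ _

/-- Off the range, the transported configuration is `1`. [folklore] -/
theorem SpinConfig.extendAlong_apply_of_forall_ne (φ : V ↪ V') (σ : SpinConfig V) {x' : V'}
    (hx' : ∀ x, φ x ≠ x') : SpinConfig.extendAlong φ σ x' = 1 := by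
  rw [SpinConfig.extendAlong, Function.extend_apply' _ _ _ (fun ⟨x, hx⟩ => hx' x hx)]
  rfl

/-- Along a bijection, transport is precomposition with the inverse. [folklore] -/
@[simp] theorem SpinConfig.extendAlong_equiv (φ : V ≃ V') (σ : SpinConfig V) :
    SpinConfig.extendAlong φ.toEmbedding σ = σ ∘ φ.symm := by
  funext x'
  obtain ⟨x, rfl⟩ := φ.surjective x'
  rw [Function.comp_apply, φ.symm_apply_apply, ← Equiv.coe_toEmbedding,
    SpinConfig.extendAlong_apply]

/-- `spinAt (φ x) (extendAlong φ σ) = spinAt x σ`. [folklore] -/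
@[simp] theorem spinAt_extendAlong (φ : V ↪ V') (σ : SpinConfig V) (x : V) :
    spinAt (φ x) (SpinConfig.extendAlong φ σ) = spinAt x σ := by
  simp [spinAt]

/-- `σ_{φ(A)}(extendAlong φ σ) = σ_A(σ)`. [folklore] -/
@[simp] theorem spinProduct_map_extendAlong (φ : V ↪ V') (σ : SpinConfig V) (A : Finset V) :
    spinProduct (A.map φ) (SpinConfig.extendAlong φ σ) = spinProduct A σ := by
  simp [spinProduct, Finset.prod_map]

/-- `σ_{φ x} σ_{φ y}(extendAlong φ σ) = σ_x σ_y(σ)`. [folklore] -/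
@[simp] theorem spinPair_extendAlong (φ : V ↪ V') (σ : SpinConfig V) (x y : V) :
    spinPair (φ x) (φ y) (SpinConfig.extendAlong φ σ) = spinPair x y σ := by
  simp [spinPair]

/-- `bondSpin (extendAlong φ σ) (e.map φ) = bondSpin σ e`. [folklore] -/
@[simp] theorem bondSpin_extendAlong_map (φ : V ↪ V') (σ : SpinConfig V) (e : Sym2 V) :
    bondSpin (SpinConfig.extendAlong φ σ) (Sym2.map φ e) = bondSpin σ e := by
  induction e using Sym2.ind with
  | _ a b => simp

/-- Transport of configurations is measurable (each coordinate is a coordinate or a constant). [folklore] -/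
@[fun_prop]
theorem SpinConfig.measurable_extendAlong (φ : V ↪ V') :
    Measurable (SpinConfig.extendAlong (φ := φ) : SpinConfig V → SpinConfig V') := by
  refine measurable_pi_lambda _ fun x' => ?_
  by_cases h : ∃ x, φ x = x'
  · obtain ⟨x, rfl⟩ := h
    simpa using measurable_pi_apply x
  · have : (fun σ : SpinConfig V => SpinConfig.extendAlong φ σ x') = fun _ => 1 := by
      funext σ
      exact SpinConfig.extendAlong_apply_of_forall_ne φ σ fun x hx => h ⟨x, hx⟩
    rw [this]
    exact measurable_const

/-- An injection `φ` is a bijection of `Λ` onto `φ(Λ)` (as sets). [folklore] -/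
theorem bijOn_coe_map (φ : V ↪ V') (Λ : Finset V) :
    Set.BijOn φ (↑Λ : Set V) (↑(Λ.map φ) : Set V') := by
  rw [Finset.coe_map]
  exact φ.injective.injOn.bijOn_image

/-- The equivalence `Λ ≃ Λ.map φ` over `φ` exists (Mathlib's `Set.BijOn.equiv`); below it is only
used through its defining property `↑(e x) = φ x`. [folklore] -/
theorem exists_equiv_map (φ : V ↪ V') (Λ : Finset V) :
    ∃ e : ↥Λ ≃ ↥(Λ.map φ), ∀ x : Λ, (e x : V') = φ x :=
  ⟨(bijOn_coe_map φ Λ).equiv, fun _ => rfl⟩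

/-- The inverse of an equivalence `Λ ≃ Λ.map φ` over `φ` on an image point. [folklore] -/
theorem equiv_map_symm_apply (φ : V ↪ V') (Λ : Finset V) {e : ↥Λ ≃ ↥(Λ.map φ)}
    (he : ∀ x : Λ, (e x : V') = φ x) {x : V} (hx : x ∈ Λ) :
    e.symm ⟨φ x, Finset.mem_map_of_mem φ hx⟩ = ⟨x, hx⟩ :=
  (Equiv.symm_apply_eq _).2 (Subtype.ext (he ⟨x, hx⟩).symm)

/-! ### Transport of the free Hamiltonian and of the free Gibbs expectation -/

section Transport

variable {G : SimpleGraph V} {G' : SimpleGraph V'} [DecidableEq V] [DecidableEq V']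
  [G.LocallyFinite] [G'.LocallyFinite]

/-- If `φ` is a graph isomorphism between `Λ` and `φ(Λ)` (induced graphs), the edges inside
`φ(Λ)` are the images of the edges inside `Λ`. (Friedli–Velenik 2017, §3.1, `ℰ_Λ`.) [cite: FriedliVelenik2017, §3.1] -/
theorem edgesIn_map (φ : V ↪ V') {Λ : Finset V}
    (hadj : ∀ x ∈ Λ, ∀ y ∈ Λ, (G'.Adj (φ x) (φ y) ↔ G.Adj x y)) :
    edgesIn G' (Λ.map φ) = (edgesIn G Λ).map ⟨Sym2.map φ, Sym2.map.injective φ.injective⟩ := by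
  ext e'
  rw [mem_edgesIn_iff, Finset.mem_map]
  constructor
  · rintro ⟨he', hmem⟩
    induction e' using Sym2.ind with
    | _ a' b' =>
      obtain ⟨a, ha, rfl⟩ := Finset.mem_map.1 (hmem a' (Sym2.mem_mk_left _ _))
      obtain ⟨b, hb, rfl⟩ := Finset.mem_map.1 (hmem _ (Sym2.mem_mk_right _ _))
      refine ⟨s(a, b), mem_edgesIn_iff.2 ⟨?_, ?_⟩, by simp⟩
      · exact (SimpleGraph.mem_edgeSet _).2 ((hadj a ha b hb).1 ((SimpleGraph.mem_edgeSet _).1 he'))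
      · intro x hx
        rcases Sym2.mem_iff.1 hx with rfl | rfl <;> assumption
  · rintro ⟨e, he, rfl⟩
    obtain ⟨he, hmem⟩ := mem_edgesIn_iff.1 he
    induction e using Sym2.ind with
    | _ a b =>
      have ha : a ∈ Λ := hmem a (Sym2.mem_mk_left _ _)
      have hb : b ∈ Λ := hmem b (Sym2.mem_mk_right _ _)
      simp only [Function.Embedding.coeFn_mk, Sym2.map_mk]
      refine ⟨?_, ?_⟩
      · rw [SimpleGraph.mem_edgeSet]
        exact (hadj a ha b hb).2 ((SimpleGraph.mem_edgeSet _).1 he)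
      · intro x' hx'
        rcases Sym2.mem_iff.1 hx' with rfl | rfl
        · exact Finset.mem_map_of_mem _ ha
        · exact Finset.mem_map_of_mem _ hb

/-- **Transport of the free Hamiltonian**: `ℋ^∅_{φ(Λ);h}(extendAlong φ σ) = ℋ^∅_{Λ;h}(σ)` when `φ`
is a graph isomorphism between `Λ` and `φ(Λ)` (Friedli–Velenik 2017, §3.1, eq. (3.2): the free
Hamiltonian only involves `ℰ_Λ` and the sites of `Λ`). [cite: FriedliVelenik2017, §3.1, eq. (3.2)] -/
theorem isingHamiltonian_free_map (φ : V ↪ V') {Λ : Finset V}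
    (hadj : ∀ x ∈ Λ, ∀ y ∈ Λ, (G'.Adj (φ x) (φ y) ↔ G.Adj x y)) (h : ℝ) (σ : SpinConfig V) :
    isingHamiltonian G' (Λ.map φ) h .free (SpinConfig.extendAlong φ σ) =
      isingHamiltonian G Λ h .free σ := by
  simp only [isingHamiltonian, interactionEdges_free, edgesIn_map φ hadj, Finset.sum_map,
    Function.Embedding.coeFn_mk, bondSpin_extendAlong_map, spinAt_extendAlong]

omit [DecidableEq V] [DecidableEq V'] in
/-- Gluing commutes with transport (free boundary condition). [folklore] -/
theorem glue_map_free (φ : V ↪ V') (Λ : Finset V) {e : ↥Λ ≃ ↥(Λ.map φ)}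
    (he : ∀ x : Λ, (e x : V') = φ x) (τ : Λ → ℤˣ) :
    glue (Λ.map φ) (τ ∘ e.symm) .free = SpinConfig.extendAlong φ (glue Λ τ .free) := by
  funext x'
  by_cases h : ∃ x, φ x = x'
  · obtain ⟨x, rfl⟩ := h
    rw [SpinConfig.extendAlong_apply]
    by_cases hx : x ∈ Λ
    · rw [glue_apply_of_mem _ _ _ (Finset.mem_map_of_mem φ hx), glue_apply_of_mem _ _ _ hx,
        Function.comp_apply, equiv_map_symm_apply φ Λ he]
    · rw [glue_apply_of_notMem _ _ _ (by simpa using hx), glue_apply_of_notMem _ _ _ hx]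
      rfl
  · push Not at h
    rw [SpinConfig.extendAlong_apply_of_forall_ne φ _ h, glue_apply_of_notMem]
    · rfl
    · intro hx'
      obtain ⟨x, -, rfl⟩ := Finset.mem_map.1 hx'
      exact h x rfl

/-- **Transport of free-boundary-condition expectations along a graph embedding.**
If `φ : V ↪ V'` is injective and a graph isomorphism between the volume `Λ` and its image
(`G'.Adj (φ x) (φ y) ↔ G.Adj x y` on `Λ`), then for every measurable observable `f` on `V'`,
`⟨f⟩^∅_{φ(Λ);β,h} = ⟨f ∘ extendAlong φ⟩^∅_{Λ;β,h}`: the free finite-volume Gibbs measure only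
depends on the induced graph (Friedli–Velenik 2017, §3.1, Def. 3.1 with eq. (3.2)). Proved by
reindexing the finite Boltzmann sums of `integral_isingMeasure`. [cite: FriedliVelenik2017, §3.1, Def. 3.1] -/
theorem isingExpect_free_map (φ : V ↪ V') {Λ : Finset V}
    (hadj : ∀ x ∈ Λ, ∀ y ∈ Λ, (G'.Adj (φ x) (φ y) ↔ G.Adj x y)) (β h : ℝ)
    {f : SpinConfig V' → ℝ} (hf : Measurable f) :
    isingExpect G' (Λ.map φ) β h .free f =
      isingExpect G Λ β h .free (fun σ => f (SpinConfig.extendAlong φ σ)) := by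
  have hf' : Measurable fun σ : SpinConfig V => f (SpinConfig.extendAlong φ σ) :=
    hf.comp (SpinConfig.measurable_extendAlong φ)
  obtain ⟨e, hex⟩ := exists_equiv_map φ Λ
  have hw : ∀ τ : Λ → ℤˣ, isingWeight G' (Λ.map φ) β h .free (τ ∘ e.symm) =
      isingWeight G Λ β h .free τ := fun τ => by
    simp only [isingWeight, glue_map_free φ Λ hex, isingHamiltonian_free_map φ hadj]
  have he : ∀ τ : Λ → ℤˣ, (e.arrowCongr (Equiv.refl ℤˣ)) τ = τ ∘ e.symm := fun τ => rfl
  have hZ : isingPartitionFunction G' (Λ.map φ) β h .free = isingPartitionFunction G Λ β h .free := by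
    unfold isingPartitionFunction
    exact (Fintype.sum_equiv (e.arrowCongr (Equiv.refl ℤˣ)) _ _ fun τ => by rw [he, hw]).symm
  unfold isingExpect
  rw [integral_isingMeasure G' _ β h _ hf, integral_isingMeasure G Λ β h _ hf', hZ]
  congr 1
  refine (Fintype.sum_equiv (e.arrowCongr (Equiv.refl ℤˣ)) _ _ fun τ => ?_).symm
  rw [he, hw, glue_map_free φ Λ hex]

/-- Transport of set correlations: `⟨σ_{φ(A)}⟩^∅_{φ(Λ);β,h} = ⟨σ_A⟩^∅_{Λ;β,h}`
(Friedli–Velenik 2017, §3.1 and §3.6.1). [cite: FriedliVelenik2017, §3.1] -/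
theorem isingCorr_free_map (φ : V ↪ V') {Λ : Finset V}
    (hadj : ∀ x ∈ Λ, ∀ y ∈ Λ, (G'.Adj (φ x) (φ y) ↔ G.Adj x y)) (β h : ℝ) (A : Finset V) :
    isingCorr G' (Λ.map φ) β h .free (A.map φ) = isingCorr G Λ β h .free A := by
  simp only [isingCorr, isingExpect_free_map φ hadj β h (measurable_spinProduct _),
    spinProduct_map_extendAlong]

/-- Transport of two-point functions: `⟨σ_{φ x} σ_{φ y}⟩^∅_{φ(Λ);β,h} = ⟨σ_x σ_y⟩^∅_{Λ;β,h}`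
(Friedli–Velenik 2017, §3.1 and §3.2). [cite: FriedliVelenik2017, §3.1] -/
theorem isingTwoPoint_free_map (φ : V ↪ V') {Λ : Finset V}
    (hadj : ∀ x ∈ Λ, ∀ y ∈ Λ, (G'.Adj (φ x) (φ y) ↔ G.Adj x y)) (β h : ℝ) (x y : V) :
    isingTwoPoint G' (Λ.map φ) β h .free (φ x) (φ y) = isingTwoPoint G Λ β h .free x y := by
  simp only [isingTwoPoint, isingExpect_free_map φ hadj β h (measurable_spinPair _ _),
    spinPair_extendAlong]

/-- Invariance of free expectations on the whole (finite) vertex set under a graph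
automorphism `φ`: `⟨f⟩^∅_{V;β,h} = ⟨f ∘ (· ∘ φ⁻¹)⟩^∅_{V;β,h}` (Friedli–Velenik 2017, §3.1).
Here `σ ∘ φ.symm` is `configReflect φ.symm σ` of `ReflectionPositivity.lean` (definitionally), so
this is the expectation-level form of the invariance `IsReflectionInvariant` used in
`InfraredBound.lean` for the torus reflections. [cite: FriedliVelenik2017, §3.1] -/
theorem isingExpect_free_univ_comp [Fintype V] (φ : V ≃ V)
    (hadj : ∀ x y, (G.Adj (φ x) (φ y) ↔ G.Adj x y)) (β h : ℝ)
    {f : SpinConfig V → ℝ} (hf : Measurable f) :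
    isingExpect G Finset.univ β h .free (fun σ => f (σ ∘ φ.symm)) =
      isingExpect G Finset.univ β h .free f := by
  have := isingExpect_free_map (G := G) (G' := G) φ.toEmbedding (Λ := Finset.univ)
    (fun x _ y _ => hadj x y) β h hf
  rw [Finset.map_univ_equiv] at this
  rw [this]
  simp

end Transport

/-! ### The torus: translation invariance and evenness of the two-point function -/

section Torus

variable {d L : ℕ} [NeZero L]

omit [NeZero L] in
/-- Translations are automorphisms of the torus graph. (Friedli–Velenik 2017, §3.1.) [cite: FriedliVelenik2017, §3.1] -/
theorem torusGraph_adj_add_right (a x y : TorusSite d L) :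
    (torusGraph d L).Adj (x + a) (y + a) ↔ (torusGraph d L).Adj x y := by
  simp only [torusGraph_adj_iff, add_right_comm _ a, add_left_inj, ne_eq]

/-- **Translation invariance of the periodic two-point function**:
`⟨σ_{x+a} σ_{y+a}⟩_{𝕋_L;β,h} = ⟨σ_x σ_y⟩_{𝕋_L;β,h}` (Friedli–Velenik 2017, §3.1 Def. 3.2, periodic
boundary condition, and §10.5.2, display before (10.40), "by translation invariance": the torus
model is invariant under the translation group of `(ℤ/Lℤ)^d`). [cite: FriedliVelenik2017, §10.5.2] -/
theorem isingTorusTwoPoint_add_right (β h : ℝ) (a x y : TorusSite d L) :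
    isingTorusTwoPoint d L β h (x + a) (y + a) = isingTorusTwoPoint d L β h x y := by
  have key := isingExpect_free_univ_comp (G := torusGraph d L) (Equiv.addRight a)
    (torusGraph_adj_add_right a) β h (measurable_spinPair (x + a) (y + a))
  have hobs : (fun σ : SpinConfig (TorusSite d L) => spinPair (x + a) (y + a)
      (σ ∘ (Equiv.addRight a).symm)) = spinPair x y := by
    funext σ
    simp [spinPair, spinAt]
  rw [hobs] at key
  exact key.symm

/-- Symmetry `⟨σ_x σ_y⟩ = ⟨σ_y σ_x⟩` of the periodic two-point function. [folklore] -/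
theorem isingTorusTwoPoint_comm (β h : ℝ) (x y : TorusSite d L) :
    isingTorusTwoPoint d L β h x y = isingTorusTwoPoint d L β h y x := by
  have hs : spinPair x y = spinPair y x := by
    funext σ
    simp [spinPair, mul_comm]
  simp only [isingTorusTwoPoint, isingTwoPoint, hs]

/-- The periodic two-point function is a function of the difference:
`⟨σ_x σ_y⟩_{𝕋_L;β,h} = G_L(y - x)` with `G_L = torusTwoPoint (isingTorusMeasure d L β h)`
(Friedli–Velenik 2017, §10.5.2, display before (10.40):
`|𝕋_L|⁻¹ ∑_{i,j} e^{ip·(j-i)} ⟨S_i·S_j⟩ = ∑_j e^{ip·j} ⟨S_0·S_j⟩`). [cite: FriedliVelenik2017, §10.5.2] -/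
theorem isingTorusTwoPoint_eq_torusTwoPoint (β h : ℝ) (x y : TorusSite d L) :
    isingTorusTwoPoint d L β h x y = torusTwoPoint (isingTorusMeasure d L β h) (y - x) := by
  have := isingTorusTwoPoint_add_right β h (-x) x y
  rw [add_neg_cancel, ← sub_eq_add_neg] at this
  rw [← this]
  rfl

/-- The periodic two-point function `G_L` is even: `G_L(-z) = G_L(z)` (symmetry of
`⟨σ_0 σ_z⟩` plus translation invariance; Friedli–Velenik 2017, §10.5.2). [cite: FriedliVelenik2017, §10.5.2] -/
theorem torusTwoPoint_isingTorusMeasure_neg (β h : ℝ) (z : TorusSite d L) :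
    torusTwoPoint (isingTorusMeasure d L β h) (-z) = torusTwoPoint (isingTorusMeasure d L β h) z := by
  have h1 := isingTorusTwoPoint_eq_torusTwoPoint (d := d) (L := L) β h z 0
  have h2 := isingTorusTwoPoint_eq_torusTwoPoint (d := d) (L := L) β h 0 z
  rw [zero_sub] at h1
  rw [sub_zero] at h2
  rw [← h1, ← h2, isingTorusTwoPoint_comm]

end Torus

end Literature.Probability.LatticeModels
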